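import Summits.QuantumFields.YangMills.Theorems.BalabanUVNodesN15KingModelTranslationCovarianceContinuum
import Summits.QuantumFields.YangMills.Theorems.BalabanUVNodesN15KingModelSrcDivReflection

/-!
# BalabanUVNodes ∕ N15 — THE KING-MODEL RUNG (PART Ϙ-f): REFLECTION COVARIANCE OF KING's `A = 0` KERNELS (`ℋ_k`, `Δ^{(k)}`, `(Δ^{(k)})⁻¹`, `G^η_{(K)}`, the
# `G`-line diagrams and their `ℋ`-legs), EVENNESS OF THE CONTINUUM TWO-POINT KERNEL IN EVERY COORDINATE, AND EXACT EXTENSIVITY OF THE FIELD-PAIRED DIAGRAM AT A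
# CONSTANT FIELD (the effective-potential density shape)
# (Track A, DAG node N15 = NE2; FAN-OUT v1.1 §N15 s3 «KING-MODEL RUNG … NE2's analogue DECIDED in the model»)

HONEST FRAMING.  Count-neutral (cell `pub-ymgap`, seat `pub-ymgap-dag-n15-e` g31; `--supports stmt-QuantumFields-27366 --as helper` = K3⁸
`SpineGivenEndpointR13SepCoPHV`).  TEMPLATE LITERATURE: C. King, *The U(1) Higgs model. I. The continuum limit*, Commun. Math. Phys. **102** (1986) 649–677
[King1986] — KING's OWN `A = 0` MODEL on the rung's tori.  NOT Bałaban's `G(U)`; NOT a node discharge (N15 is booked through n15-a's knit, untouched here); nothing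
continuum ∕ ℝ⁴ ∕ OS ∕ mass-gap ∕ Clay.  0 `sorry`; standard axioms.  Sequel of parts Ϙ-a…Ϙ-d (`…TranslationCovariance{,Rung,Graphs,Continuum}`) using the rung's
block-face reflection `torRefl` (`…N15TorusReflections`, n15-a programme N) and its King-side letters `blockOf_torRefl`, `lapF_torRefl`, `fineOp_inv_torRefl`
(`…N15KingModelSrcDivReflection`, this seat's programme-Y file).

THE PRINT.  King's `A = 0` operators on the torus are invariant under the full symmetry group of the block decomposition — translations by block vectors (parts
Ϙ-a…Ϙ-e) and the reflections in block faces (p. 670: the free-boundary-condition propagators are obtained from the periodic ones *«by using multiple reflection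
representations»* [Ba 4], which presupposes the reflection covariance typed here); the two-point functions are therefore even functions of the separation, the
lattice remnant of Euclidean invariance ([King1986II] restores the rotations).  (3.40) p. 660 pairs a diagram's legs with a field; at a CONSTANT field the pairing
is `|T^{(k)}|` times a number — the shape of an effective-potential density.

WHAT THIS FILE PROVES (kernel; 0 `def`).  §1 (generic, any finite index types): `inv_equiv` (the inverse of an `e`-invariant matrix is `e`-invariant, any
permutation `e`), `mul_equiv₃` (covariant × covariant along three bijections), ★ `graphValLS_equiv` (a diagram with `e`-invariant lines is unchanged when all
one-vertex factors are `e`-transported).  §2 (King's operators under `σ = torRefl … κ` on both lattices): `Qmat_torRefl`, ★ `constrainedProp_torRefl`, `lapF_inv_torRefl`,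
★ `topPiece_torRefl`, ★★ `minimiserMat_torRefl`∕`minimiser_single_torRefl` (`ℋ_k(σx, σb) = ℋ_k(x, b)`), ★★ `effLaplacian_torRefl`, ★★ `effLaplacian_inv_torRefl`.
§3 (rung objects): `kingGLine_torRefl_none` (`G`-lines), `kingH_torRefl`, `kingExtLo_torRefl_none`, ★ `blockCov_torRefl`∕`blockCovStep_torRefl` (NE2's unit kernel of the
model is reflection invariant).  §4 (diagrams): ★ `king_graph_legsLo_torRefl` (all lines `G`, all legs `ℋ`: reflecting every leg site leaves the diagram unchanged),
★★ `kingPairSeq_torRefl`, ★★★ **`kingPairLim_torRefl`** and ★★★ **`kingPairLim_even`** (THE CONTINUUM TWO-POINT KERNEL OF A `G`-LINE DIAGRAM IS AN EVEN FUNCTION OF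
THE SEPARATION IN EVERY COORDINATE: `E^{(∞)}(G; b, b + σ̇v) = E^{(∞)}(G; b, b + v)`, `σ̇ = torNeg κ`).  §5 (constant fields): ★ `king_graph_fieldSum_const`,
★★ **`kingFieldSeq_const_eq_card_mul`** (`E^{(K+1)}(G; φ ≡ c) = |T^{(K)}|·c^{r+1}·Σ_w E^{(K+1)}(G; y_{b₀}, {y_{w_l}})` for EVERY `b₀` — exact extensivity of the
field-paired diagram at a constant field).

HONEST SCOPE.  Torus ∕ periodic b.c., flat block mean, `A = 0`.  §3–§4 are stated for `G`-lines and `ℋ`-legs (kinds `none`): a derivative line `∂^η_κG` or leg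
`∂^η_κℋ` in the reflected direction goes to MINUS the BACKWARD difference, so diagrams with derivative kinds are covariant only up to those sign∕orientation changes,
not typed here.  Identities only; N15 untouched; counts unmoved.
Locators: [King1986] (2.10)–(2.15) pp.652–653, (2.17) p.653, (3.40) p.660, Prop. 3.6 (3.56) p.662, Prop. 3.8 (3.71) p.664, (4.1)–(4.5) p.670 («multiple reflection representations»), (4.44) p.675.
-/

noncomputable section

open scoped BigOperators
open Finset Matrix Filter

/-! ## §1 Generic: covariance along bijections of finite index types -/

namespace Summit.QuantumFields.YangMills.BalabanUVNodes.N15KingModelRung.Graph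

section Equiv

variable {X Y Z : Type*} [Fintype X] [Fintype Y] [Fintype Z] [DecidableEq X]

/-- **The inverse of an `e`-invariant real matrix is `e`-invariant**, for any permutation `e` (Mathlib `Matrix.inv_submatrix_equiv`; no invertibility needed). [folklore] -/
theorem inv_equiv (e : X ≃ X) {T : Matrix X X ℝ} (hT : ∀ x y, T (e x) (e y) = T x y) (x y : X) : T⁻¹ (e x) (e y) = T⁻¹ x y := by
  have h : T.submatrix e e = T := Matrix.ext fun x y => hT x y
  have h2 : T⁻¹.submatrix e e = T⁻¹ := by rw [← Matrix.inv_submatrix_equiv, h]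
  exact congr_fun (congr_fun h2 x) y

omit [Fintype X] [Fintype Z] [DecidableEq X] in
/-- **Covariant × covariant = covariant** along bijections `e, f, g`: `A(ex, fy) = A(x, y)`, `B(fy, gz) = B(y, z)` ⇒ `(AB)(ex, gz) = (AB)(x, z)`. [folklore] -/
theorem mul_equiv₃ (A : Matrix X Y ℝ) (B : Matrix Y Z ℝ) (e : X → X) (f : Y ≃ Y) (g : Z → Z)
    (hA : ∀ x y, A (e x) (f y) = A x y) (hB : ∀ y z, B (f y) (g z) = B y z) (x : X) (z : Z) :
    (A * B) (e x) (g z) = (A * B) x z := by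
  simp only [Matrix.mul_apply]
  calc ∑ y, A (e x) y * B y (g z) = ∑ y, A (e x) (f y) * B (f y) (g z) := (f.sum_comp (fun y => A (e x) y * B y (g z))).symm
    _ = ∑ y, A x y * B y z := Finset.sum_congr rfl fun y _ => by rw [hA, hB]

variable {V Λ Υ T : Type*} [Fintype V] [DecidableEq V] [Fintype Λ] [Fintype Υ] [Fintype T] {𝕂 : Type*} [CommSemiring 𝕂]

omit [Fintype X] [Fintype Y] [Fintype Z] [DecidableEq X] in
/-- ★ **A DIAGRAM WITH `e`-INVARIANT LINES IS UNCHANGED WHEN ALL ITS ONE-VERTEX FACTORS ARE `e`-TRANSPORTED** (any bijection `e` of the site type: re-index the vertex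
assignments `σ ↦ e∘σ`). [cite: King1986, (3.55)–(3.59) pp.662–663] -/
theorem graphValLS_equiv (e : T ≃ T) (w : 𝕂) (src tgt : Λ → V) (G : Λ → T → T → 𝕂) (vtx : Υ → V) (u u' : Υ → T → 𝕂)
    (hG : ∀ ℓ x y, G ℓ (e x) (e y) = G ℓ x y) (hu : ∀ υ x, u' υ (e x) = u υ x) :
    graphValLS w src tgt G vtx u' = graphValLS w src tgt G vtx u := by
  unfold graphValLS
  calc ∑ σ : V → T, w ^ Fintype.card V * ((∏ ℓ, G ℓ (σ (src ℓ)) (σ (tgt ℓ))) * ∏ υ, u' υ (σ (vtx υ)))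
      = ∑ σ : V → T, w ^ Fintype.card V
          * ((∏ ℓ, G ℓ ((Equiv.piCongrRight (fun _ : V => e) σ) (src ℓ)) ((Equiv.piCongrRight (fun _ : V => e) σ) (tgt ℓ)))
            * ∏ υ, u' υ ((Equiv.piCongrRight (fun _ : V => e) σ) (vtx υ))) :=
        (Fintype.sum_equiv (Equiv.piCongrRight fun _ : V => e) _ _ fun _ => rfl).symm
    _ = ∑ σ : V → T, w ^ Fintype.card V * ((∏ ℓ, G ℓ (σ (src ℓ)) (σ (tgt ℓ))) * ∏ υ, u υ (σ (vtx υ))) :=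
        Finset.sum_congr rfl fun σ _ => by simp only [Equiv.piCongrRight_apply, Pi.map_apply, hG, hu]

end Equiv

end Summit.QuantumFields.YangMills.BalabanUVNodes.N15KingModelRung.Graph

namespace Summit.QuantumFields.YangMills.BalabanUVNodes.N15KingModelRung.Curved

open Literature.MathematicalPhysics.QuantumFieldTheory.Balaban1983to89.B5Prop11Plancherel (Tor fine)
open Literature.MathematicalPhysics.QuantumFieldTheory.King1986 (aK)
open Literature.MathematicalPhysics.QuantumFieldTheory.King1986.Torus
open Summit.QuantumFields.YangMills.BalabanUVNodes.N15.TwoGrid (torRefl torNeg torRefl_torRefl torRefl_injective torRefl_bijective torRefl_add torRefl_sub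
  torRefl_add_unitVec_ne torRefl_add_unitVec_same)
open Summit.QuantumFields.YangMills.BalabanUVNodes.N15.KingModel.SrcDiv (blockOf_torRefl lapF_torRefl fineOp_torRefl fineOp_inv_torRefl)
open Summit.QuantumFields.YangMills.BalabanUVNodes.N15KingModelRung
open Summit.QuantumFields.YangMills.BalabanUVNodes.N15KingModelRung.Graph

variable {d : ℕ} (L : ℕ) [NeZero L]

/-! ## §2 King's operators under the block-face reflection `σ = torRefl` (fine lattice) ∕ `σ = torRefl` (unit lattice) -/

section Operators

variable (N : ℕ) [NeZero N] (M : Fin (d + 1) → ℕ) [∀ μ, NeZero (M μ)] (κ : Fin (d + 1))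

omit [NeZero L] in
/-- **The block mean is reflection covariant**: `Q(σb, σx) = Q(b, x)`. [cite: King1986, (2.10) p.653] -/
theorem Qmat_torRefl (b : Tor M) (x : Tor (fine N M)) :
    Qmat N M (torRefl M κ b) (torRefl (fine N M) κ x) = Qmat N M b x := by
  simp only [Qmat, blockOf_torRefl, torRefl_injective.eq_iff]

omit [NeZero L] in
/-- ★ **`G^η_k(σx, σy) = G^η_k(x, y)`.** [cite: King1986, (2.13) p.653, (4.1)–(4.5) p.670] -/
theorem constrainedProp_torRefl (a c m2 : ℝ) (x y : Tor (fine N M)) :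
    constrainedProp N M a c m2 (torRefl (fine N M) κ x) (torRefl (fine N M) κ y) = constrainedProp N M a c m2 x y := by
  rw [constrainedProp, Matrix.smul_apply, Matrix.smul_apply, fineOp_inv_torRefl]

omit [NeZero L] in
/-- `C^η(σx, σy) = C^η(x, y)` (on any torus `Π_μ ℤ∕K_μ`). [cite: King1986, (2.17) p.653, (4.4) p.670] -/
theorem lapF_inv_torRefl (K : Fin (d + 1) → ℕ) [∀ μ, NeZero (K μ)] (c m2 : ℝ) (x y : Tor K) :
    (lapF K c m2)⁻¹ (torRefl K κ x) (torRefl K κ y) = (lapF K c m2)⁻¹ x y :=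
  inv_equiv (Function.Involutive.toPerm (torRefl K κ) torRefl_torRefl) (fun x' y' => lapF_torRefl κ c m2 x' y') x y

omit [NeZero L] in
/-- ★ **The top piece is reflection invariant**: `G^η_{(K)}(σx, σy) = G^η_{(K)}(x, y)`. [cite: King1986, (2.17) p.653, (4.44) p.675] -/
theorem topPiece_torRefl (a c m2 : ℝ) (x y : Tor (fine N M)) :
    topPiece N M a c m2 (torRefl (fine N M) κ x) (torRefl (fine N M) κ y) = topPiece N M a c m2 x y := by
  rw [topPiece, Matrix.smul_apply, Matrix.smul_apply, Matrix.sub_apply, Matrix.sub_apply, lapF_inv_torRefl, fineOp_inv_torRefl]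

omit [NeZero L] in
/-- ★★ **The minimiser kernel is reflection covariant**: `ℋ_k(σx, σb) = ℋ_k(x, b)`. [cite: King1986, (2.15) p.653] -/
theorem minimiserMat_torRefl (a c m2 : ℝ) (x : Tor (fine N M)) (b : Tor M) :
    minimiserMat N M a c m2 (torRefl (fine N M) κ x) (torRefl M κ b) = minimiserMat N M a c m2 x b := by
  rw [minimiserMat, Matrix.smul_apply, Matrix.smul_apply]
  congr 1
  exact mul_equiv₃ _ _ (torRefl (fine N M) κ) (Function.Involutive.toPerm (torRefl (fine N M) κ) torRefl_torRefl) (torRefl M κ)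
    (fun x' y' => fineOp_inv_torRefl κ N M a c m2 x' y') (fun y' b' => by
      rw [Matrix.transpose_apply, Matrix.transpose_apply]; exact Qmat_torRefl N M κ b' y') x b

omit [NeZero L] in
/-- `ℋ_k(σx, σb) = ℋ_k(x, b)` in the `minimiser (δ_b)` spelling. [cite: King1986, (2.15) p.653] -/
theorem minimiser_single_torRefl (a c m2 : ℝ) (x : Tor (fine N M)) (b : Tor M) :
    minimiser N M a c m2 (Pi.single (torRefl M κ b) 1) (torRefl (fine N M) κ x) = minimiser N M a c m2 (Pi.single b 1) x := by
  rw [← minimiserMat_apply, ← minimiserMat_apply, minimiserMat_torRefl]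

omit [NeZero L] in
/-- ★★ **`Δ^{(k)}(σb, σb′) = Δ^{(k)}(b, b′)`.** [cite: King1986, (2.14) p.653, (4.5) p.670] -/
theorem effLaplacian_torRefl (a c m2 : ℝ) (b b' : Tor M) :
    effLaplacian N M a c m2 (torRefl M κ b) (torRefl M κ b') = effLaplacian N M a c m2 b b' := by
  rw [effLaplacian, Matrix.sub_apply, Matrix.sub_apply, Matrix.smul_apply, Matrix.smul_apply, Matrix.smul_apply, Matrix.smul_apply,
    Matrix.one_apply, Matrix.one_apply]
  simp only [torRefl_injective.eq_iff]
  congr 2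
  refine mul_equiv₃ _ _ (torRefl M κ) (Function.Involutive.toPerm (torRefl (fine N M) κ) torRefl_torRefl) (torRefl M κ) (fun b₁ y₁ => ?_)
    (fun y' b'' => by rw [Matrix.transpose_apply, Matrix.transpose_apply]; exact Qmat_torRefl N M κ b'' y') b b'
  exact mul_equiv₃ _ _ (torRefl M κ) (Function.Involutive.toPerm (torRefl (fine N M) κ) torRefl_torRefl) (torRefl (fine N M) κ)
    (fun b₃ x₃ => Qmat_torRefl N M κ b₃ x₃) (fun x' y' => fineOp_inv_torRefl κ N M a c m2 x' y') b₁ y₁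

omit [NeZero L] in
/-- ★★ **`(Δ^{(k)})⁻¹(σb, σb′) = (Δ^{(k)})⁻¹(b, b′)`** — the block covariance is reflection invariant. [cite: King1986, (2.14) p.653, (4.5) p.670, (4.41) p.675] -/
theorem effLaplacian_inv_torRefl (a c m2 : ℝ) (b b' : Tor M) :
    (effLaplacian N M a c m2)⁻¹ (torRefl M κ b) (torRefl M κ b') = (effLaplacian N M a c m2)⁻¹ b b' :=
  inv_equiv (Function.Involutive.toPerm (torRefl M κ) torRefl_torRefl) (fun b₁ b₂ => effLaplacian_torRefl N M κ a c m2 b₁ b₂) b b'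

end Operators

/-! ## §3 The rung's objects: `G`-lines, `ℋ`-legs, the NE2 unit kernel -/

section Rung

variable (κ : Fin (d + 1))

/-- `G^η_K(σx, σy) = G^η_K(x, y)` for the rung's `G`-line kernel. [cite: King1986, (2.13) p.653, p.663] -/
theorem kingGLine_torRefl_none (M : Fin (d + 1) → ℕ) [∀ μ, NeZero (M μ)] (a msq : ℝ) (k : ℕ) (x y : Tor (fine (L ^ k) M)) :
    kingGLine L M a msq k none (torRefl (fine (L ^ k) M) κ x) (torRefl (fine (L ^ k) M) κ y) = kingGLine L M a msq k none x y :=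
  constrainedProp_torRefl (L ^ k) M κ _ _ _ x y

omit [NeZero L] in
/-- `ℋ_K(σx, σb) = ℋ_K(x, b)` for the rung's `kingH`. [cite: King1986, (2.15) p.653, Prop. 3.8 (3.71) p.664] -/
theorem kingH_torRefl (Nf : ℕ) [NeZero Nf] (M : Fin (d + 1) → ℕ) [∀ μ, NeZero (M μ)] (a m2 : ℝ) (k : ℕ) (b : Tor M) (x : Tor (fine Nf M)) :
    kingH L Nf M a m2 k (torRefl M κ b) (torRefl (fine Nf M) κ x) = kingH L Nf M a m2 k b x :=
  minimiser_single_torRefl Nf M κ _ _ _ x b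

/-- The coarse `ℋ`-leg is reflection covariant: `kingExtLo (σb) none (σx) = kingExtLo b none x`. [cite: King1986, Prop. 3.8 (3.71) p.664] -/
theorem kingExtLo_torRefl_none (a msq : ℝ) (j : KingVolIndex d) (b : Tor (kingVol L j))
    (x : haveI := kingVol_neZero L j; Tor (fine (L ^ j.K) (kingVol L j))) :
    haveI := kingVol_neZero L j
    kingExtLo L a msq j (torRefl (kingVol L j) κ b) none (torRefl (fine (L ^ j.K) (kingVol L j)) κ x) = kingExtLo L a msq j b none x := by
  haveI := kingVol_neZero L j
  exact kingH_torRefl L κ (L ^ j.K) (kingVol L j) a msq j.K b x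

omit [NeZero L] in
/-- ★ **`(Δ^{(K)})⁻¹(σb, σb′) = (Δ^{(K)})⁻¹(b, b′)`** for the rung's `blockCov`. [cite: King1986, (4.5) p.670, (4.41) p.675] -/
theorem blockCov_torRefl (Nf : ℕ) [NeZero Nf] (M : Fin (d + 1) → ℕ) [∀ μ, NeZero (M μ)] (a m2 : ℝ) (K : ℕ) (b b' : Tor M) :
    blockCov L Nf M a m2 K (torRefl M κ b) (torRefl M κ b') = blockCov L Nf M a m2 K b b' :=
  effLaplacian_inv_torRefl Nf M κ _ _ _ b b'

/-- ★ **… and its η-difference** (NE2's unit kernel of the model is reflection invariant). [cite: King1986, (4.39)–(4.41) pp.674–675] -/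
theorem blockCovStep_torRefl (a m2 : ℝ) (j : KingVolIndex d) (b b' : Tor (kingVol L j)) :
    blockCovStep L a m2 j (torRefl (kingVol L j) κ b) (torRefl (kingVol L j) κ b') = blockCovStep L a m2 j b b' := by
  haveI := kingVol_neZero L j
  haveI : NeZero (L ^ 1 * L ^ j.K) := ⟨mul_ne_zero (pow_ne_zero _ (NeZero.ne L)) (pow_ne_zero _ (NeZero.ne L))⟩
  unfold blockCovStep
  rw [blockCov_torRefl, blockCov_torRefl]

end Rung

/-! ## §4 `G`-line diagrams with `ℋ`-legs: reflecting every leg site; the continuum two-point kernel is even -/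

section Graphs

variable (κ : Fin (d + 1)) (a msq : ℝ) {nn m : ℕ} (src tgt : Fin m → Fin (nn + 1))

/-- ★ **REFLECTING ALL THE LEGS' UNIT SITES LEAVES A `G`-LINE DIAGRAM UNCHANGED** (all lines `G^η_K`, all legs `ℋ_K`, any weight, any leg family). [cite: King1986, Prop. 3.6 (3.56) p.662, Prop. 3.8 (3.71) p.664, (4.1)–(4.5) p.670] -/
theorem king_graph_legsLo_torRefl (jv : KingVolIndex d) (w : ℝ) {Υ : Type*} [Fintype Υ] (vtx : Υ → Fin (nn + 1)) (b : Υ → Tor (kingVol L jv)) :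
    haveI := kingVol_neZero L jv
    graphValLS w src tgt (fun _ => kingGLine L (kingVol L jv) a msq jv.K none) vtx
        (fun υ => kingExtLo L a msq jv (torRefl (kingVol L jv) κ (b υ)) none)
      = graphValLS w src tgt (fun _ => kingGLine L (kingVol L jv) a msq jv.K none) vtx (fun υ => kingExtLo L a msq jv (b υ) none) := by
  haveI := kingVol_neZero L jv
  exact graphValLS_equiv (Function.Involutive.toPerm (torRefl (fine (L ^ jv.K) (kingVol L jv)) κ) torRefl_torRefl) _ _ _ _ _ _ _
    (fun _ x y => kingGLine_torRefl_none L κ (kingVol L jv) a msq jv.K x y) (fun υ x => kingExtLo_torRefl_none L κ a msq jv (b υ) x)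

/-- ★★ **THE TWO-POINT KERNEL ALONG `K` IS REFLECTION INVARIANT** (`G`-lines, `ℋ`-legs): `E^{(K+1)}(G; y_{σb}, y_{σb′}) = E^{(K+1)}(G; y_b, y_{b′})`.
[cite: King1986, Prop. 3.6 (3.56) p.662, (4.1)–(4.5) p.670] -/
theorem kingPairSeq_torRefl (eM : ℕ) (v₁ : Fin (nn + 1)) (b b' : Tor (kingVol L (jvSucc (d := d) eM 0))) (K : ℕ) :
    kingPairSeq L a msq eM nn m src tgt (fun _ => none) v₁ none none (torRefl (kingVol L (jvSucc (d := d) eM 0)) κ b)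
        (torRefl (kingVol L (jvSucc (d := d) eM 0)) κ b') K
      = kingPairSeq L a msq eM nn m src tgt (fun _ => none) v₁ none none b b' K := by
  unfold kingPairSeq
  have hlegs : (fun υ => kingExtLo L a msq (jvSucc (d := d) eM K)
        (![torRefl (kingVol L (jvSucc (d := d) eM 0)) κ b, torRefl (kingVol L (jvSucc (d := d) eM 0)) κ b'] υ) (![none, none] υ))
      = fun υ => kingExtLo L a msq (jvSucc (d := d) eM K) (torRefl (kingVol L (jvSucc (d := d) eM K)) κ (![b, b'] υ)) none := by
    funext υ; fin_cases υ <;> rfl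
  have hlegs' : (fun υ => kingExtLo L a msq (jvSucc (d := d) eM K) (![b, b'] υ) (![none, none] υ))
      = fun υ => kingExtLo L a msq (jvSucc (d := d) eM K) (![b, b'] υ) none := by
    funext υ; fin_cases υ <;> rfl
  rw [hlegs, hlegs']
  exact king_graph_legsLo_torRefl L κ a msq src tgt (jvSucc (d := d) eM K) _ ![(0 : Fin (nn + 1)), v₁] ![b, b']

/-- ★★★ **THE CONTINUUM TWO-POINT KERNEL IS REFLECTION INVARIANT**: `E^{(∞)}(G; σb, σb′) = E^{(∞)}(G; b, b′)` (`G`-lines, `ℋ`-legs; no convergence hypothesis —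
the defining sequences coincide). [cite: King1986, Thm 2.1 (i) (2.22) p.654, (4.1)–(4.5) p.670] -/
theorem kingPairLim_torRefl (eM : ℕ) (v₁ : Fin (nn + 1)) (b b' : Tor (kingVol L (jvSucc (d := d) eM 0))) :
    kingPairLim L a msq eM nn m src tgt (fun _ => none) v₁ none none (torRefl (kingVol L (jvSucc (d := d) eM 0)) κ b)
        (torRefl (kingVol L (jvSucc (d := d) eM 0)) κ b')
      = kingPairLim L a msq eM nn m src tgt (fun _ => none) v₁ none none b b' := by
  unfold kingPairLim
  rw [show kingPairSeq L a msq eM nn m src tgt (fun _ => none) v₁ none none (torRefl (kingVol L (jvSucc (d := d) eM 0)) κ b)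
      (torRefl (kingVol L (jvSucc (d := d) eM 0)) κ b') = kingPairSeq L a msq eM nn m src tgt (fun _ => none) v₁ none none b b' from
    funext fun K => kingPairSeq_torRefl L κ a msq src tgt eM v₁ b b' K]

/-- ★★★ **THE CONTINUUM TWO-POINT KERNEL IS EVEN IN EVERY COORDINATE OF THE SEPARATION**: `E^{(∞)}(G; b, b + σ̇v) = E^{(∞)}(G; b, b + v)` with `σ̇ = torNeg κ`
(`v ↦ (…, −v_κ, …)`) — reflection invariance (this §) composed with translation invariance (part Ϙ-d `kingPairLim_transl`). [cite: King1986, Thm 2.1 (i) (2.22) p.654, (4.1)–(4.5) p.670] -/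
theorem kingPairLim_even (eM : ℕ) (v₁ : Fin (nn + 1)) (b v : Tor (kingVol L (jvSucc (d := d) eM 0))) :
    kingPairLim L a msq eM nn m src tgt (fun _ => none) v₁ none none b (b + torNeg (kingVol L (jvSucc (d := d) eM 0)) κ v)
      = kingPairLim L a msq eM nn m src tgt (fun _ => none) v₁ none none b (b + v) := by
  have h1 := kingPairLim_torRefl L κ a msq src tgt eM v₁ b (b + v)
  rw [torRefl_add] at h1
  have h2 := kingPairLim_transl L a msq eM src tgt (fun _ => none) v₁ none none (torRefl (kingVol L (jvSucc (d := d) eM 0)) κ b)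
    (torRefl (kingVol L (jvSucc (d := d) eM 0)) κ b + torNeg (kingVol L (jvSucc (d := d) eM 0)) κ v)
    (b - torRefl (kingVol L (jvSucc (d := d) eM 0)) κ b)
  rw [add_sub_cancel, show torRefl (kingVol L (jvSucc (d := d) eM 0)) κ b + torNeg (kingVol L (jvSucc (d := d) eM 0)) κ v
      + (b - torRefl (kingVol L (jvSucc (d := d) eM 0)) κ b) = b + torNeg (kingVol L (jvSucc (d := d) eM 0)) κ v by abel] at h2
  rw [h2, h1]

end Graphs

/-! ## §5 Constant fields: exact extensivity of the field-paired diagram -/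

section ConstField

variable (a msq : ℝ) {nn m : ℕ} (src tgt : Fin m → Fin (nn + 1)) (κ : Fin m → Option (Fin (d + 1))) (κ₀ : Option (Fin (d + 1)))
  {r : ℕ} (vtxF : Fin r → Fin (nn + 1)) (κF : Fin r → Option (Fin (d + 1)))

/-- ★ **THE LEG SUM DOES NOT DEPEND ON THE ROOT SITE**: `Σ_w E(G; y_{y₀}, {y_{w_l}}) = Σ_w E(G; y_{b₀}, {y_{w_l}})` (translate every leg by `y₀ − b₀` and re-index `w`).
[cite: King1986, (3.40) p.660, Prop. 3.8 (3.71) p.664, (4.1)–(4.2) p.670] -/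
theorem king_graph_fieldSum_const (jv : KingVolIndex d) (wt : ℝ) (y₀ b₀ : Tor (kingVol L jv)) :
    haveI := kingVol_neZero L jv
    ∑ w : Fin r → Tor (kingVol L jv),
        graphValLS wt src tgt (fun ℓ => kingGLine L (kingVol L jv) a msq jv.K (κ ℓ)) (Sum.elim (fun _ : Unit => (0 : Fin (nn + 1))) vtxF)
          (fun υ => kingExtLo L a msq jv (Sum.elim (fun _ : Unit => y₀) w υ) (Sum.elim (fun _ : Unit => κ₀) κF υ))
      = ∑ w : Fin r → Tor (kingVol L jv),
        graphValLS wt src tgt (fun ℓ => kingGLine L (kingVol L jv) a msq jv.K (κ ℓ)) (Sum.elim (fun _ : Unit => (0 : Fin (nn + 1))) vtxF)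
          (fun υ => kingExtLo L a msq jv (Sum.elim (fun _ : Unit => b₀) w υ) (Sum.elim (fun _ : Unit => κ₀) κF υ)) := by
  haveI := kingVol_neZero L jv
  set v := y₀ - b₀ with hv
  have hy : y₀ = b₀ + v := by rw [hv, add_sub_cancel]
  refine Fintype.sum_equiv (Equiv.subRight (fun _ : Fin r => v)) _ _ fun w => ?_
  -- `E(legs y₀, w) = E(legs b₀ + v, (w − v) + v) = E(legs b₀, w − v)`
  have hlegs : (fun υ => kingExtLo L a msq jv (Sum.elim (fun _ : Unit => y₀) w υ) (Sum.elim (fun _ : Unit => κ₀) κF υ))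
      = fun υ => kingExtLo L a msq jv (Sum.elim (fun _ : Unit => b₀) (Equiv.subRight (fun _ : Fin r => v) w) υ + v)
          (Sum.elim (fun _ : Unit => κ₀) κF υ) := by
    funext υ
    rcases υ with _ | l
    · simp only [Sum.elim_inl, hy]
    · simp only [Sum.elim_inr, Equiv.subRight_apply, Pi.sub_apply, sub_add_cancel]
  rw [hlegs]
  exact king_graph_legsLo_transl L a msq jv src tgt κ wt _ _ _ v

/-- ★★ **EXACT EXTENSIVITY OF THE FIELD-PAIRED DIAGRAM AT A CONSTANT FIELD**: `E^{(K+1)}(G; φ ≡ c) = |T^{(K)}| · c^{r+1} · Σ_w E^{(K+1)}(G; y_{b₀}, {y_{w_l}})` for EVERY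
block `b₀` — part Β-g's `kingFieldSeq` at the constant field is the unit-torus volume times a number (the shape of an effective-potential density; (3.40) at constant
`φ`). [cite: King1986, (3.40) p.660, Thm 2.1 (ii) (2.23) p.654, (4.1)–(4.2) p.670] -/
theorem kingFieldSeq_const_eq_card_mul (eM : ℕ) (c : ℝ) (b₀ : Tor (kingVol L (jvSucc (d := d) eM 0))) (K : ℕ) :
    haveI := kingVol_neZero L (jvSucc (d := d) eM K)
    kingFieldSeq L a msq eM nn m src tgt κ κ₀ r vtxF κF (fun _ => c) K
      = (Fintype.card (Tor (kingVol L (jvSucc (d := d) eM K))) : ℝ) * (c ^ (r + 1) *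
        ∑ w : Fin r → Tor (kingVol L (jvSucc (d := d) eM K)),
          graphValLS ((((L : ℝ) ^ (K + 1))⁻¹) ^ (d + 1)) src tgt (fun ℓ => kingGLine L (kingVol L (jvSucc (d := d) eM K)) a msq (K + 1) (κ ℓ))
            (Sum.elim (fun _ : Unit => (0 : Fin (nn + 1))) vtxF)
            (fun υ => kingExtLo L a msq (jvSucc (d := d) eM K) (Sum.elim (fun _ : Unit => b₀) w υ) (Sum.elim (fun _ : Unit => κ₀) κF υ))) := by
  haveI := kingVol_neZero L (jvSucc (d := d) eM K)
  unfold kingFieldSeq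
  have hconst : (c * ∏ _l : Fin r, c) = c ^ (r + 1) := by
    rw [Finset.prod_const, Finset.card_univ, Fintype.card_fin, pow_succ']
  have hS : ∀ y₀ : Tor (kingVol L (jvSucc (d := d) eM K)),
      (∑ w : Fin r → Tor (kingVol L (jvSucc (d := d) eM K)),
        graphValLS ((((L : ℝ) ^ (K + 1))⁻¹) ^ (d + 1)) src tgt (fun ℓ => kingGLine L (kingVol L (jvSucc (d := d) eM K)) a msq (K + 1) (κ ℓ))
          (Sum.elim (fun _ : Unit => (0 : Fin (nn + 1))) vtxF)
          (fun υ => kingExtLo L a msq (jvSucc (d := d) eM K) (Sum.elim (fun _ : Unit => y₀) w υ) (Sum.elim (fun _ : Unit => κ₀) κF υ)))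
      = ∑ w : Fin r → Tor (kingVol L (jvSucc (d := d) eM K)),
        graphValLS ((((L : ℝ) ^ (K + 1))⁻¹) ^ (d + 1)) src tgt (fun ℓ => kingGLine L (kingVol L (jvSucc (d := d) eM K)) a msq (K + 1) (κ ℓ))
          (Sum.elim (fun _ : Unit => (0 : Fin (nn + 1))) vtxF)
          (fun υ => kingExtLo L a msq (jvSucc (d := d) eM K) (Sum.elim (fun _ : Unit => b₀) w υ) (Sum.elim (fun _ : Unit => κ₀) κF υ)) :=
    fun y₀ => king_graph_fieldSum_const L a msq src tgt κ κ₀ vtxF κF (jvSucc (d := d) eM K) _ y₀ b₀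
  simp only [hconst]
  simp only [← Finset.mul_sum]
  rw [Finset.sum_congr rfl (fun y₀ _ => hS y₀), Finset.sum_const, Finset.card_univ, nsmul_eq_mul]
  ring

end ConstField

end Summit.QuantumFields.YangMills.BalabanUVNodes.N15KingModelRung.Curved

end
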